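import Mathlib.RingTheory.DedekindDomain.AdicValuation
import Literature.NumberTheory.Automorphic.SymplecticGroupCartanDecomposition
import Literature.NumberTheory.Automorphic.GelfandPair
import HarnessLib

/-!
# `(Sp(J, K), Sp(J, 𝒪))` is a Gelfand pair: symmetric double cosets and the commutativity of the
# spherical Hecke algebra of the symplectic group over a discretely valued field

Topic `NumberTheory/Automorphic`; namespace `Literature.NumberTheory.Automorphic.SymplecticCartan` (lane `lit-hodgefound`,
Track 2 foundations; seat `lit-hodgefound-p11`, generation 34, row g34-#4, file 5).  ONE definition (`symplecticInt`, the
subgroup `Sp(J, 𝒪) ≤ Sp(J, K)` of integral symplectic matrices, with its membership API) and theorems; no named fact, no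
instance, no notation (D-0026).

## The print

[AndrianovZhuravlev1995] Ch. 3 §3 (held text `galaxy-panama-466270239588381`, chars 369500–381637): after Lemma 3.6
(symplectic divisors `sd(M) = diag(d₁, …, d_n; e₁, …, e_n) ∈ Γ M Γ`), «THEOREM 3.7. For `n, q ∈ ℕ` the ring `Lⁿ(q)` is
commutative.» with the proof: the transpose `M ↦ ᵗM` is an anti-automorphism preserving `Γ = Sp_n(ℤ)`, and
`sd(ᵗM) = sd(M)`, so every double coset is stable and the Hecke ring is commutative (Gelfand's trick; the book phrases it
through the anti-automorphism `X ↦ X*` of `Lⁿ(q)`, «`(J_n M₀ J_n⁻¹)_Γ = (M₀)_Γ = (M)_Γ`»).  Local form: Satake / [Tits1979]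
§3.3.3 (hyperspecial `K`), [Kottwitz1992] §7 (the Hecke algebras at hyperspecial places are commutative); the abstract
Gelfand lemma used is the tree's `isGelfandPair_of_inv_mem_doubleCoset` [CeccherinisilbersteScarabottiTolli2018, Cor. 13.3.6].

## What is formalised (`K` a field with `Valued K ℤᵐ⁰`, `l` a finite index type, `J = (0 -1; 1 0)`)

* §1 `symplecticInt l K : Subgroup (symplecticGroup l K)` — `Sp(J, 𝒪)`: symplectic matrices with all entries of valuation
  `≤ 1` (closed under inverse because `A⁻¹ = -J Aᵀ J`); `mem_symplecticInt_iff`, `v_J_apply_le_one`, `J_mem_symplecticInt`,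
  `v_mul_apply_le_one`.
* §2 `J_mul_diagonal` (`J · diag(d) = diag(d ∘ swap) · J`): conjugation by `J ∈ Sp(J, 𝒪)` inverts the torus elements
  `diag(d₁; d₂)`, `d₁ d₂ = 1` (`J_mul_diagonal_mul_J_inv`, in the group).
* §3 **`inv_mem_doubleCoset_symplecticInt`** — with a uniformiser `ϖ`: every `g ∈ Sp(J, K)` has
  `g⁻¹ ∈ Sp(J, 𝒪) g Sp(J, 𝒪)` (Cartan decomposition `exists_cartan_decomposition` + §2), i.e. all double cosets are
  symmetric; **`isGelfandPair_symplecticInt`** — the Hecke algebra `ℋ(Sp(J, K), Sp(J, 𝒪))` over any commutative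
  coefficient ring is commutative.
* §4 the place-wise instances `inv_mem_doubleCoset_symplecticInt_adicCompletion`, **`isGelfandPair_symplecticInt_adicCompletion`**:
  for a Dedekind domain `R` with fraction field `F` and any finite place `v`, `(Sp(J, F_v), Sp(J, 𝒪_v))` is a Gelfand pair
  (a uniformiser of `F_v` comes from `F`, Mathlib `valuation_exists_uniformizer`).

## References
* [AndrianovZhuravlev1995] A. N. Andrianov, V. G. Zhuravlev, *Modular Forms and Hecke Operators*, Transl. Math. Monogr. 145,
  AMS (1995), Ch. 3 §3, Lemma 3.6, Theorem 3.7.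
* [Tits1979] J. Tits, *Reductive groups over local fields*, Proc. Symp. Pure Math. 33.1 (1979), §3.3.3.
* [Kottwitz1992] R. E. Kottwitz, J. AMS 5 (1992), §7.
* [CeccherinisilbersteScarabottiTolli2018] T. Ceccherini-Silberstein, F. Scarabotti, F. Tolli (2018), Cor. 13.3.6.
-/

noncomputable section

open scoped Valued WithZero
open Matrix

namespace Literature.NumberTheory.Automorphic.SymplecticCartan

variable {K : Type*} [Field K] {l : Type*} [Fintype l] [DecidableEq l]

/-! ## §1 The hyperspecial subgroup `Sp(J, 𝒪)` -/

section Valued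

variable [Valued K ℤᵐ⁰]

/-- Entries of a product of integral matrices are integral. [cite: AndrianovZhuravlev1995, Ch. 3 §3] -/
theorem v_mul_apply_le_one {ι : Type*} [Fintype ι] {A B : Matrix ι ι K} (hA : ∀ i j, Valued.v (A i j) ≤ 1)
    (hB : ∀ i j, Valued.v (B i j) ≤ 1) (i j : ι) : Valued.v ((A * B) i j) ≤ 1 := by
  rw [Matrix.mul_apply]
  refine Valued.v.map_sum_le fun k _ => ?_
  rw [map_mul]
  exact mul_le_one' (hA i k) (hB k j)

omit [Fintype l] in
/-- The entries of `J` are `0`, `±1`, hence integral. [cite: AndrianovZhuravlev1995, Ch. 3 §3 (3.1)] -/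
theorem v_J_apply_le_one (k k' : l ⊕ l) : Valued.v (J l K k k') ≤ 1 := by
  rcases k with i | i <;> rcases k' with j | j
  · rw [Matrix.J, Matrix.fromBlocks_apply₁₁, Matrix.zero_apply, map_zero]; exact zero_le
  · rw [Matrix.J, Matrix.fromBlocks_apply₁₂, Matrix.neg_apply, Matrix.one_apply, Valuation.map_neg]
    by_cases hij : i = j
    · rw [if_pos hij, map_one]
    · rw [if_neg hij, map_zero]; exact zero_le
  · rw [Matrix.J, Matrix.fromBlocks_apply₂₁, Matrix.one_apply]
    by_cases hij : i = j
    · rw [if_pos hij, map_one]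
    · rw [if_neg hij, map_zero]; exact zero_le
  · rw [Matrix.J, Matrix.fromBlocks_apply₂₂, Matrix.zero_apply, map_zero]; exact zero_le

/-- **`Sp(J, 𝒪)`** — the subgroup of `Sp(J, K) = Matrix.symplecticGroup l K` of matrices with entries in the valuation
ring `𝒪 = {v ≤ 1}` (the hyperspecial maximal compact subgroup when `K` is a local field); closed under inverses because
`A⁻¹ = -J Aᵀ J` for symplectic `A`. [cite: AndrianovZhuravlev1995, Ch. 3 §3 (the group `Γⁿ = Sp_n(ℤ)` and its local
analogue); Tits1979, §3.3.3] -/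
def symplecticInt (l K : Type*) [Field K] [Valued K ℤᵐ⁰] [Fintype l] [DecidableEq l] :
    Subgroup (symplecticGroup l K) where
  carrier := {A | ∀ i j, Valued.v ((A : Matrix (l ⊕ l) (l ⊕ l) K) i j) ≤ 1}
  mul_mem' := fun {A B} hA hB => by
    intro i j
    exact v_mul_apply_le_one hA hB i j
  one_mem' := by
    intro i j
    rw [show ((1 : symplecticGroup l K) : Matrix (l ⊕ l) (l ⊕ l) K) = 1 from rfl, Matrix.one_apply]
    split_ifs
    · rw [map_one]
    · rw [map_zero]; exact zero_le
  inv_mem' := fun {A} hA => by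
    intro i j
    have hA' : ∀ a b, Valued.v ((A : Matrix (l ⊕ l) (l ⊕ l) K) a b) ≤ 1 := hA
    rw [SymplecticGroup.coe_inv, Matrix.neg_mul, Matrix.neg_mul, Matrix.neg_apply, Valuation.map_neg]
    refine v_mul_apply_le_one (fun i' j' => v_mul_apply_le_one (fun a b => v_J_apply_le_one a b)
      (fun a b => ?_) i' j') (fun a b => v_J_apply_le_one a b) i j
    rw [Matrix.transpose_apply]; exact hA' b a

/-- Membership in `Sp(J, 𝒪)`: all entries integral. [cite: Tits1979, §3.3.3] -/
theorem mem_symplecticInt_iff {A : symplecticGroup l K} :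
    A ∈ symplecticInt l K ↔ ∀ i j, Valued.v ((A : Matrix (l ⊕ l) (l ⊕ l) K) i j) ≤ 1 := Iff.rfl

/-- The entries of the inverse of an element of `Sp(J, 𝒪)` are integral too. [cite: Tits1979, §3.3.3] -/
theorem v_inv_apply_le_one_of_mem_symplecticInt {A : symplecticGroup l K} (hA : A ∈ symplecticInt l K) (i j : l ⊕ l) :
    Valued.v (((A⁻¹ : symplecticGroup l K) : Matrix (l ⊕ l) (l ⊕ l) K) i j) ≤ 1 :=
  mem_symplecticInt_iff.1 ((symplecticInt l K).inv_mem hA) i j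

/-- `J ∈ Sp(J, 𝒪)`. [cite: AndrianovZhuravlev1995, Ch. 3 §3] -/
theorem J_mem_symplecticInt : (⟨J l K, SymplecticGroup.J_mem l K⟩ : symplecticGroup l K) ∈ symplecticInt l K :=
  mem_symplecticInt_iff.2 fun k k' => v_J_apply_le_one k k'

end Valued

/-! ## §2 Conjugation by `J` inverts the diagonal torus -/

/-- `J · diag(d) = diag(d ∘ swap) · J`. [cite: AndrianovZhuravlev1995, Ch. 3 §3 («`J_n M₀ J_n⁻¹`»)] -/
theorem J_mul_diagonal (d : l ⊕ l → K) :
    J l K * Matrix.diagonal d = Matrix.diagonal (d ∘ Sum.swap) * J l K := by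
  ext k k'
  rw [Matrix.mul_diagonal, Matrix.diagonal_mul, Function.comp_apply]
  rcases k with i | i <;> rcases k' with j | j
  · rw [Matrix.J, Matrix.fromBlocks_apply₁₁, Matrix.zero_apply, zero_mul, mul_zero]
  · rw [Matrix.J, Matrix.fromBlocks_apply₁₂, Matrix.neg_apply, Matrix.one_apply, Sum.swap_inl]
    by_cases hij : i = j
    · subst hij; rw [if_pos rfl, mul_comm]
    · rw [if_neg hij, neg_zero, zero_mul, mul_zero]
  · rw [Matrix.J, Matrix.fromBlocks_apply₂₁, Matrix.one_apply, Sum.swap_inr]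
    by_cases hij : i = j
    · subst hij; rw [if_pos rfl, mul_comm]
    · rw [if_neg hij, zero_mul, mul_zero]
  · rw [Matrix.J, Matrix.fromBlocks_apply₂₂, Matrix.zero_apply, zero_mul, mul_zero]

/-- In the group `Sp(J, K)`: for a torus element `T = diag(d₁; d₂)` with `d₁ d₂ = 1`, `J T J⁻¹ = T⁻¹`.
[cite: AndrianovZhuravlev1995, Ch. 3 §3] -/
theorem J_mul_diagonal_mul_J_inv {d : l ⊕ l → K} (hd : ∀ i, d (Sum.inl i) * d (Sum.inr i) = 1) :
    (⟨J l K, SymplecticGroup.J_mem l K⟩ : symplecticGroup l K) * ⟨Matrix.diagonal d, diagonal_mem_symplecticGroup hd⟩ *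
        (⟨J l K, SymplecticGroup.J_mem l K⟩ : symplecticGroup l K)⁻¹ =
      (⟨Matrix.diagonal d, diagonal_mem_symplecticGroup hd⟩ : symplecticGroup l K)⁻¹ := by
  -- `T' = diag(d ∘ swap)` is the inverse of `T`, and `J T = T' J`
  have hd' : ∀ i, (d ∘ Sum.swap) (Sum.inl i) * (d ∘ Sum.swap) (Sum.inr i) = 1 := fun i => by
    rw [Function.comp_apply, Function.comp_apply, Sum.swap_inl, Sum.swap_inr, mul_comm]; exact hd i
  set Jm : symplecticGroup l K := ⟨J l K, SymplecticGroup.J_mem l K⟩ with hJm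
  set Tm : symplecticGroup l K := ⟨Matrix.diagonal d, diagonal_mem_symplecticGroup hd⟩ with hTm
  set T'm : symplecticGroup l K := ⟨Matrix.diagonal (d ∘ Sum.swap), diagonal_mem_symplecticGroup hd'⟩ with hT'm
  have hinv : T'm * Tm = 1 := by
    refine Subtype.ext ?_
    show Matrix.diagonal (d ∘ Sum.swap) * Matrix.diagonal d = 1
    rw [Matrix.diagonal_mul_diagonal, ← Matrix.diagonal_one]
    refine congrArg Matrix.diagonal (funext fun k => ?_)
    rcases k with i | i
    · rw [Function.comp_apply, Sum.swap_inl, mul_comm]; exact hd i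
    · rw [Function.comp_apply, Sum.swap_inr]; exact hd i
  have hJT : Jm * Tm = T'm * Jm := Subtype.ext (J_mul_diagonal d)
  rw [← eq_inv_of_mul_eq_one_left hinv, mul_inv_eq_iff_eq_mul, hJT]

/-! ## §3 Symmetric double cosets and the Gelfand pair -/

section Gelfand

variable [Valued K ℤᵐ⁰] {ϖ : K}

/-- **Every `Sp(J, 𝒪)`-double coset of `Sp(J, K)` is symmetric**: `g⁻¹ ∈ Sp(J, 𝒪) g Sp(J, 𝒪)` (`K` discretely valued
with a uniformiser `ϖ`).  From the Cartan decomposition `k₁ g k₂ = T = diag(ϖ^{a}; ϖ^{-a})` and `J T J⁻¹ = T⁻¹`: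
`g⁻¹ = (k₂ J k₁) g (k₂ J⁻¹ k₁)`. [cite: AndrianovZhuravlev1995, Ch. 3 §3, proof of Theorem 3.7; Tits1979, §3.3.3] -/
theorem inv_mem_doubleCoset_symplecticInt (hϖ : Valued.v ϖ = WithZero.exp (-1 : ℤ)) (g : symplecticGroup l K) :
    g⁻¹ ∈ DoubleCoset.doubleCoset g (symplecticInt l K) (symplecticInt l K) := by
  have hϖ0 : ϖ ≠ 0 := fun h0 => by
    rw [h0, map_zero] at hϖ
    exact WithZero.coe_ne_zero hϖ.symm
  obtain ⟨k₁, k₂, a, h1, h2, h3, h4, hT⟩ := exists_cartan_decomposition hϖ g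
  have hd : ∀ i, Sum.elim (fun i => ϖ ^ a i) (fun i => (ϖ ^ a i)⁻¹) (Sum.inl i) *
      Sum.elim (fun i => ϖ ^ a i) (fun i => (ϖ ^ a i)⁻¹) (Sum.inr i) = 1 := fun i => by
    rw [Sum.elim_inl, Sum.elim_inr]; exact mul_inv_cancel₀ (pow_ne_zero _ hϖ0)
  set Jm : symplecticGroup l K := ⟨J l K, SymplecticGroup.J_mem l K⟩ with hJm
  have hTm : k₁ * g * k₂ = ⟨_, diagonal_mem_symplecticGroup hd⟩ := Subtype.ext hT
  have hconj : Jm * (k₁ * g * k₂) * Jm⁻¹ = (k₁ * g * k₂)⁻¹ := by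
    rw [hTm]; exact J_mul_diagonal_mul_J_inv hd
  have hk₁ : k₁ ∈ symplecticInt l K := mem_symplecticInt_iff.2 h1
  have hk₂ : k₂ ∈ symplecticInt l K := mem_symplecticInt_iff.2 h3
  have hJ : Jm ∈ symplecticInt l K := J_mem_symplecticInt
  refine DoubleCoset.mem_doubleCoset.2 ⟨k₂ * Jm * k₁, (symplecticInt l K).mul_mem ((symplecticInt l K).mul_mem hk₂ hJ) hk₁,
    k₂ * Jm⁻¹ * k₁, (symplecticInt l K).mul_mem ((symplecticInt l K).mul_mem hk₂ ((symplecticInt l K).inv_mem hJ)) hk₁, ?_⟩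
  calc g⁻¹ = k₂ * (k₁ * g * k₂)⁻¹ * k₁ := by group
    _ = k₂ * (Jm * (k₁ * g * k₂) * Jm⁻¹) * k₁ := by rw [hconj]
    _ = k₂ * Jm * k₁ * g * (k₂ * Jm⁻¹ * k₁) := by group

/-- **`(Sp(J, K), Sp(J, 𝒪))` is a Gelfand pair**: the Hecke algebra `ℋ(Sp(J, K), Sp(J, 𝒪))` (bi-invariant finitely
supported functions under convolution, coefficients in any commutative ring `k`) is COMMUTATIVE — `K` any discretely
valued field with a uniformiser (Gelfand's trick for `g ↦ g⁻¹` on the symmetric double cosets).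
[cite: AndrianovZhuravlev1995, Ch. 3 §3, Theorem 3.7; Tits1979, §3.3.3; CeccherinisilbersteScarabottiTolli2018, Cor. 13.3.6] -/
theorem isGelfandPair_symplecticInt (k : Type*) [CommRing k] (hϖ : Valued.v ϖ = WithZero.exp (-1 : ℤ)) :
    IsGelfandPair k (symplecticGroup l K) (symplecticInt l K) :=
  isGelfandPair_of_inv_mem_doubleCoset fun g => inv_mem_doubleCoset_symplecticInt hϖ g

end Gelfand

/-! ## §4 At the finite places of a Dedekind domain -/

section AdicCompletion

open IsDedekindDomain

variable {R : Type*} [CommRing R] [IsDedekindDomain R] {F : Type*} [Field F] [Algebra R F] [IsFractionRing R F]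
  (v : HeightOneSpectrum R)

/-- **Symmetric double cosets at every finite place**: for `g ∈ Sp(J, F_v)`, `g⁻¹ ∈ Sp(J, 𝒪_v) g Sp(J, 𝒪_v)`.
[cite: AndrianovZhuravlev1995, Ch. 3 §3, Theorem 3.7; Tits1979, §3.3.3] -/
theorem inv_mem_doubleCoset_symplecticInt_adicCompletion (g : symplecticGroup l (v.adicCompletion F)) :
    g⁻¹ ∈ DoubleCoset.doubleCoset g (symplecticInt l (v.adicCompletion F)) (symplecticInt l (v.adicCompletion F)) := by
  obtain ⟨π, hπ⟩ := HeightOneSpectrum.valuation_exists_uniformizer F v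
  have hϖ : Valued.v (π : v.adicCompletion F) = WithZero.exp (-1 : ℤ) := by
    rw [HeightOneSpectrum.valuedAdicCompletion_eq_valuation', hπ]
  exact inv_mem_doubleCoset_symplecticInt hϖ g

/-- **`(Sp(J, F_v), Sp(J, 𝒪_v))` is a Gelfand pair at every finite place `v`** of a Dedekind domain `R` with fraction
field `F` (e.g. `R = 𝓞 F` of a number field): the spherical Hecke algebra of `Sp` at `v` is commutative.
[cite: AndrianovZhuravlev1995, Ch. 3 §3, Theorem 3.7; Tits1979, §3.3.3; Kottwitz1992, §7] -/
theorem isGelfandPair_symplecticInt_adicCompletion (k : Type*) [CommRing k] :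
    IsGelfandPair k (symplecticGroup l (v.adicCompletion F)) (symplecticInt l (v.adicCompletion F)) :=
  isGelfandPair_of_inv_mem_doubleCoset fun g => inv_mem_doubleCoset_symplecticInt_adicCompletion v g

end AdicCompletion

end Literature.NumberTheory.Automorphic.SymplecticCartan

end
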